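import Summits.QuantumAdvantage.QuantumAdvantage.Theorems.ScaleDialCA

/-! # ScaleDialC — part 2/2 (mechanical split for landing of `ScaleDialC`; content verbatim; scopes re-opened with their variables) -/

set_option linter.dupNamespace false
set_option linter.style.longLine false
noncomputable section
open scoped Classical

namespace Summit.QuantumAdvantage.QuantumAdvantage.Theorems.ScaleDial
open Finset
open Literature.Computability.QuantumComplexity Literature.Computability.QuantumComplexity.RingHLF
open Literature.Computability.MetaComplexity Literature.Computability.MetaComplexity.Smolensky
open Summit.QuantumAdvantage.AdviceFreeQNC0
open Summit.QuantumAdvantage.QuantumAdvantage.Theorems.RingPeriodFold (cov covStrat covStrat_mem_lowDeg)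
open Summit.QuantumAdvantage.QuantumAdvantage.Theses.ExactnessDial (NoPerfectOdd3 PolyLossOddU3 MassStep3u OddToAll3
  DPLift3 MultiRingBridge3 NoPerfectConst3)

section Absorb

/-- ScaleDialC helper `le_lDeg` (decomp-qadv land package; see the module docstring). -/
theorem le_lDeg (D j : ℕ) : D ≤ lDeg D j := by unfold lDeg; omega
/-- ScaleDialC helper `lDeg_le_eDeg` (decomp-qadv land package; see the module docstring). -/
theorem lDeg_le_eDeg (D j : ℕ) : lDeg D j ≤ eDeg D j := by
  unfold lDeg eDeg
  have h : j * (D + 1) ≤ j * (j + 1) * (D + 1) := by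
    rw [mul_assoc]; exact Nat.mul_le_mul_left _ (Nat.le_mul_of_pos_left _ (by omega))
  omega
/-- ScaleDialC helper `lDeg_mono` (decomp-qadv land package; see the module docstring). -/
theorem lDeg_mono (D : ℕ) {j j' : ℕ} (h : j ≤ j') : lDeg D j ≤ lDeg D j' := by
  unfold lDeg; exact Nat.add_le_add_left (Nat.mul_le_mul_right _ h) _
/-- ScaleDialC helper `eDeg_mono` (decomp-qadv land package; see the module docstring). -/
theorem eDeg_mono (D : ℕ) {j j' : ℕ} (h : j ≤ j') : eDeg D j ≤ eDeg D j' := by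
  unfold eDeg; exact Nat.add_le_add_left (Nat.mul_le_mul_right _ (Nat.mul_le_mul h (by omega))) _
/-- ScaleDialC helper `eDeg_le` (decomp-qadv land package; see the module docstring). -/
theorem eDeg_le (D j : ℕ) : eDeg D j ≤ (j + 1) ^ 2 * (D + 1) := by unfold eDeg; nlinarith
/-- ScaleDialC helper `eDeg_zero` (decomp-qadv land package; see the module docstring). -/
theorem eDeg_zero (D : ℕ) : eDeg D 0 = D := by unfold eDeg; ring
/-- ScaleDialC helper `lDeg_zero` (decomp-qadv land package; see the module docstring). -/
theorem lDeg_zero (D : ℕ) : lDeg D 0 = D := by unfold lDeg; ring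

/-- one stitch advances the ladder index by one. -/
theorem profLE_stitch_step {N D j : ℕ} {P : Str (N + 1)}
    (h : ProfLE N P (eDeg D j + lDeg D j + 1) D (D + lDeg D j + 1)) : ProfLE N P (eDeg D (j + 1)) D (lDeg D (j + 1)) :=
  profLE_mono (eDeg_step D j) (lDeg_step D j).le h

/-- one fold advances the ladder index by (at most) one. -/
theorem profLE_fold_step {N D j : ℕ} {P : Str (N + 1)}
    (h : ProfLE N P (eDeg D j + D) D (D + lDeg D j)) : ProfLE N P (eDeg D (j + 1)) D (lDeg D (j + 1)) :=
  profLE_mono (by have := eDeg_step D j; have := le_lDeg D j; omega) (by rw [← lDeg_step]; omega) h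

/-! ### C6. The two tokens `U = SSS`, `V = S∘F` (both shorten by `3`; told apart by the bit at position `m+2`) -/

/-- token `U`: three `Y`-deletions. -/
def uTok {m : ℕ} (x : Fin (m + 1) → Bool) : Fin (m + 4) → Bool := yLift (yLift (yLift x))

/-- token `V`: a `00`-fold, then one `Y`-deletion. -/
def vTok {m : ℕ} (x : Fin (m + 1) → Bool) : Fin (m + 4) → Bool := yLift (pad x)

/-- ScaleDialC helper `yLift_injective` (decomp-qadv land package; see the module docstring). -/
theorem yLift_injective {m : ℕ} : Function.Injective (yLift (m := m)) := by
  intro x y h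
  funext i
  have h1 := congrFun h (Fin.castSucc i)
  rw [yLift_castSucc, yLift_castSucc] at h1
  revert h1; cases x i <;> cases y i <;> cases bdry m i <;> decide

/-- ScaleDialC helper `pad_injective` (decomp-qadv land package; see the module docstring). -/
theorem pad_injective {n : ℕ} : Function.Injective (pad (n := n)) := by
  intro x y h
  funext i
  have h1 := congrFun h (Fin.castAdd 2 i)
  rwa [pad_castAdd, pad_castAdd] at h1

/-- ScaleDialC helper `uTok_injective` (decomp-qadv land package; see the module docstring). -/
theorem uTok_injective {m : ℕ} : Function.Injective (uTok (m := m)) :=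
  fun _ _ h => yLift_injective (yLift_injective (yLift_injective h))

/-- ScaleDialC helper `vTok_injective` (decomp-qadv land package; see the module docstring). -/
theorem vTok_injective {m : ℕ} : Function.Injective (vTok (m := m)) :=
  fun _ _ h => pad_injective (yLift_injective h)

/-- ScaleDialC helper `oddZeros_uTok` (decomp-qadv land package; see the module docstring). -/
theorem oddZeros_uTok {m : ℕ} (hm : 1 ≤ m) (x : Fin (m + 1) → Bool) : OddZeros (uTok x) ↔ OddZeros x := by
  unfold uTok
  rw [oddZeros_yLift_iff (by omega), oddZeros_yLift_iff (by omega), oddZeros_yLift_iff hm]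

/-- ScaleDialC helper `oddZeros_vTok` (decomp-qadv land package; see the module docstring). -/
theorem oddZeros_vTok {m : ℕ} (x : Fin (m + 1) → Bool) (hx : OddZeros x) : OddZeros (vTok x) := by
  unfold vTok
  rw [oddZeros_yLift_iff (by omega)]
  exact oddZeros_pad x hx

/-- ScaleDialC helper `uTok_mid` (decomp-qadv land package; see the module docstring). -/
theorem uTok_mid {m : ℕ} (x : Fin (m + 1) → Bool) : uTok x ⟨m + 2, by omega⟩ = false := by
  unfold uTok
  rw [yLift_apply_lt _ (show (⟨m + 2, _⟩ : Fin (m + 4)).val < m + 2 + 1 by simp)]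
  have h1 : yLift (yLift x) ⟨m + 2, by omega⟩ = true := yLift_apply_eq _ rfl
  have h2 : bdry (m + 2) ⟨m + 2, by omega⟩ = true := by simp [bdry]
  simp only [] at h1 h2 ⊢
  rw [h1, h2]; rfl

/-- ScaleDialC helper `vTok_mid` (decomp-qadv land package; see the module docstring). -/
theorem vTok_mid {m : ℕ} (x : Fin (m + 1) → Bool) : vTok x ⟨m + 2, by omega⟩ = true := by
  unfold vTok
  rw [yLift_apply_lt _ (show (⟨m + 2, _⟩ : Fin (m + 4)).val < m + 2 + 1 by simp)]
  have h1 : pad x ⟨m + 2, by omega⟩ = false := pad_apply_ge _ (by simp)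
  have h2 : bdry (m + 2) ⟨m + 2, by omega⟩ = true := by simp [bdry]
  simp only [] at h1 h2 ⊢
  rw [h1, h2]; rfl

/-- **token `U` pulls back three ladder steps**, wins transported exactly. -/
theorem u_pull {m : ℕ} (hm : 2 ≤ m) {D j : ℕ} (P : Str (m + 4)) (hP : ProfLE (m + 3) P (eDeg D j) D (lDeg D j)) :
    ∃ S : Str (m + 1), ProfLE m S (eDeg D (j + 3)) D (lDeg D (j + 3)) ∧ ∀ x, Wins P (uTok x) ↔ Wins S x := by
  obtain ⟨P₁, hP₁, hw₁⟩ := stitch_pull (m := m + 2) (by omega) P hP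
  obtain ⟨P₂, hP₂, hw₂⟩ := stitch_pull (m := m + 1) (by omega) P₁ (profLE_stitch_step hP₁)
  obtain ⟨S, hS, hw₃⟩ := stitch_pull (m := m) hm P₂ (profLE_stitch_step hP₂)
  exact ⟨S, profLE_stitch_step hS, fun x => (hw₁ _).trans ((hw₂ _).trans (hw₃ x))⟩

/-- **token `V` pulls back (two operations, bounded by three ladder steps)**, wins transported downward. -/
theorem v_pull {m : ℕ} (hm : 2 ≤ m) {D j : ℕ} (P : Str (m + 4)) (hP : ProfLE (m + 3) P (eDeg D j) D (lDeg D j)) :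
    ∃ R : Str (m + 1), ProfLE m R (eDeg D (j + 3)) D (lDeg D (j + 3)) ∧ ∀ x, Wins P (vTok x) → Wins R x := by
  obtain ⟨P₁, hP₁, hw₁⟩ := stitch_pull (m := m + 2) (by omega) P hP
  obtain ⟨R, hR, hw₂⟩ := fold_pull (N := m) (by omega) P₁ (profLE_stitch_step hP₁)
  refine ⟨R, profLE_mono (eDeg_mono D (by omega)) (lDeg_mono D (by omega)) (profLE_fold_step hR), fun x hw => ?_⟩
  exact hw₂ x ((hw₁ (pad x)).1 hw)

/-! ### C7. ABSORPTION by induction on the number of tokens -/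

/-- **ABSORPTION (profile form).** On `C_{m+1+3k}` (`m ≥ 2`), an indicator strategy at ladder index `j` with fewer than
`2^k` odd-class losses pulls back along a loss-free token face to a PERFECT indicator strategy on `C_{m+1}` at ladder
index `j + 3k`. -/
theorem absorb_aux (D : ℕ) : ∀ k : ℕ, ∀ m : ℕ, 2 ≤ m → ∀ N : ℕ, N = m + 3 * k → ∀ (j : ℕ) (P : Str (N + 1)),
    ProfLE N P (eDeg D j) D (lDeg D j) → (losers (N + 1) P).card < 2 ^ k →
    ∃ S : Str (m + 1), ProfLE m S (eDeg D (j + 3 * k)) D (lDeg D (j + 3 * k)) ∧ ∀ x, OddZeros x → Wins S x := by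
  intro k
  induction k with
  | zero =>
    intro m hm N hN j P hP hl
    have hN' : m = N := by omega
    subst hN'
    refine ⟨P, by simpa using hP, fun x hx => ?_⟩
    have hc : (losers (m + 1) P).card = 0 := by rw [pow_zero] at hl; omega
    have h0 : losers (m + 1) P = ∅ := Finset.card_eq_zero.1 hc
    by_contra hw
    have hx' : x ∈ losers (m + 1) P := by
      rw [losers, mem_filter]; exact ⟨mem_univ _, hx, hw⟩
    rw [h0] at hx'
    simp at hx'
  | succ k ih =>
    intro m hm N hN j P hP hl
    have hN' : N = m + 3 * k + 3 := by omega
    subst hN'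
    let idx : Fin (m + 3 * k + 3 + 1) := ⟨m + 3 * k + 2, by omega⟩
    let LU := (losers (m + 3 * k + 3 + 1) P).filter fun x' => x' idx = false
    let LV := (losers (m + 3 * k + 3 + 1) P).filter fun x' => ¬ x' idx = false
    have hsum : LU.card + LV.card = (losers (m + 3 * k + 3 + 1) P).card :=
      Finset.card_filter_add_card_filter_not _
    have h2 : 2 ^ (k + 1) = 2 ^ k + 2 ^ k := by ring
    rcases (show LU.card < 2 ^ k ∨ LV.card < 2 ^ k by omega) with hU | hV
    · -- the `U`-face carries fewer than `2^k` losses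
      obtain ⟨S, hS, hwin⟩ := u_pull (m := m + 3 * k) (by omega) P hP
      have hcard : (losers (m + 3 * k + 1) S).card ≤ LU.card := by
        refine Finset.card_le_card_of_injOn uTok (fun x hx => ?_) (uTok_injective.injOn)
        rw [mem_coe, losers, mem_filter] at hx
        rw [mem_coe]
        show uTok x ∈ LU
        rw [mem_filter, losers, mem_filter]
        exact ⟨⟨mem_univ _, (oddZeros_uTok (by omega) x).2 hx.2.1, fun hw => hx.2.2 ((hwin x).1 hw)⟩, uTok_mid x⟩
      obtain ⟨S₀, hS₀, hw₀⟩ := ih m hm (m + 3 * k) rfl (j + 3) S hS (lt_of_le_of_lt hcard hU)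
      refine ⟨S₀, ?_, hw₀⟩
      have e : j + 3 + 3 * k = j + 3 * (k + 1) := by ring
      rw [e] at hS₀
      exact hS₀
    · -- the `V`-face carries fewer than `2^k` losses
      obtain ⟨R, hR, hwin⟩ := v_pull (m := m + 3 * k) (by omega) P hP
      have hcard : (losers (m + 3 * k + 1) R).card ≤ LV.card := by
        refine Finset.card_le_card_of_injOn vTok (fun x hx => ?_) (vTok_injective.injOn)
        rw [mem_coe, losers, mem_filter] at hx
        rw [mem_coe]
        show vTok x ∈ LV
        rw [mem_filter, losers, mem_filter]
        refine ⟨⟨mem_univ _, oddZeros_vTok x hx.2.1, fun hw => hx.2.2 (hwin x hw)⟩, ?_⟩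
        rw [vTok_mid x]; decide
      obtain ⟨S₀, hS₀, hw₀⟩ := ih m hm (m + 3 * k) rfl (j + 3) R hR (lt_of_le_of_lt hcard hV)
      refine ⟨S₀, ?_, hw₀⟩
      have e : j + 3 + 3 * k = j + 3 * (k + 1) := by ring
      rw [e] at hS₀
      exact hS₀

/-- **ABSORPTION LAW (degree form).** If a degree-`d` strategy on `C_n`, `n = m + 1 + 3k`, `m ≥ 2`, loses fewer than
`2^k` odd-class patterns, then `C_{m+1}` carries a PERFECT strategy of degree `≤ (3k+1)²·(2d+1)`. -/
theorem absorb {n m k d : ℕ} (hn : n = m + 3 * k + 1) (hm : 2 ≤ m) (P : Fin n → CubeFn (ZMod 3) n)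
    (hP : ∀ i, P i ∈ lowDeg (ZMod 3) n d) (hl : (losers n P).card < 2 ^ k) :
    PerfectAt (m + 1) ((3 * k + 1) ^ 2 * (2 * d + 1)) := by
  subst hn
  let Q : Str (m + 3 * k + 1) := fun i => iota (P i)
  have hprof : ProfLE (m + 3 * k) Q (eDeg (2 * d) 0) (2 * d) (lDeg (2 * d) 0) := by
    rw [eDeg_zero, lDeg_zero]
    exact ⟨fun i => iota_isInd _, iota_mem_lowDeg (hP 0), iota_mem_lowDeg (hP _), fun i _ _ => iota_mem_lowDeg (hP i)⟩
  have hl' : (losers (m + 3 * k + 1) Q).card < 2 ^ k := by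
    have : losers (m + 3 * k + 1) Q = losers (m + 3 * k + 1) P := by
      unfold losers
      refine Finset.filter_congr fun x _ => ?_
      have hb : (fun i => decide (Q i x = 1)) = fun i => decide (P i x = 1) := by
        funext i; exact iota_bit (P i) x
      rw [hb]
    rw [this]; exact hl
  obtain ⟨S, hS, hwin⟩ := absorb_aux (2 * d) k m hm _ rfl 0 Q hprof hl'
  refine ⟨S, fun i => ?_, hwin⟩
  have hall := profLE_all hS ((le_lDeg _ _).trans (lDeg_le_eDeg _ _)) (lDeg_le_eDeg _ _)
  refine lowDeg_mono ?_ (hall i)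
  calc eDeg (2 * d) (0 + 3 * k) ≤ (0 + 3 * k + 1) ^ 2 * (2 * d + 1) := eDeg_le _ _
    _ = (3 * k + 1) ^ 2 * (2 * d + 1) := by ring

/-- **the exchange rate, hardness form**: no perfect strategy of degree `(3k+1)²(2d+1)` on `C_{m+1}` (`m ≥ 2`) ⟹ every
degree-`d` strategy on `C_{m+1+3k}` loses at least `2^k` odd patterns. -/
theorem two_pow_le_losers {m k d : ℕ} (hm : 2 ≤ m) (h : ¬ PerfectAt (m + 1) ((3 * k + 1) ^ 2 * (2 * d + 1)))
    (P : Fin (m + 3 * k + 1) → CubeFn (ZMod 3) (m + 3 * k + 1))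
    (hP : ∀ i, P i ∈ lowDeg (ZMod 3) (m + 3 * k + 1) d) : 2 ^ k ≤ (losers (m + 3 * k + 1) P).card := by
  by_contra hlt
  exact h (absorb rfl hm P hP (by omega))

/-! ### C8. Asymptotics: exactness forces quasi-polynomially many losses -/

/-- ScaleDialC helper `log_le_log_add_one` (decomp-qadv land package; see the module docstring). -/
theorem log_le_log_add_one {n m : ℕ} (hm : 1 ≤ m) (h : n ≤ 2 * m) : Nat.log 2 n ≤ Nat.log 2 m + 1 := by
  calc Nat.log 2 n ≤ Nat.log 2 (m * 2) := Nat.log_mono_right (by omega)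
    _ = Nat.log 2 m + 1 := Nat.log_mul_base (by norm_num) (by omega)

/-- ScaleDialC helper `pow_mul_pow_le` (decomp-qadv land package; see the module docstring). -/
theorem pow_mul_pow_le {L c a : ℕ} (hL : 2 ^ (c + a) ≤ L) : 2 ^ a * (L + 1) ^ c ≤ L ^ (c + 1) := by
  have hL1 : 1 ≤ L := le_trans (Nat.one_le_two_pow) hL
  calc 2 ^ a * (L + 1) ^ c ≤ 2 ^ a * (2 * L) ^ c := Nat.mul_le_mul_left _ (Nat.pow_le_pow_left (by omega) c)
    _ = 2 ^ (c + a) * L ^ c := by rw [mul_pow, pow_add]; ring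
    _ ≤ L * L ^ c := Nat.mul_le_mul_right _ hL
    _ = L ^ (c + 1) := by rw [pow_succ]; ring

/-- **THE BOTTOM LAW: `NoPerfectOdd3 → QML3`** — at polylog degree, exactness on the odd class already forces
`2^((log₂ n)^A)` odd-class losses for every `A` (absorption with `k = (log₂ n)^A` tokens; the shorter cycle has length
`≥ n/2` and the pulled-back degree `(3k+1)²(2(log₂ n)^c+1) ≤ (log₂ (n/2))^(2A+c+1)` is still polylog). -/
theorem qml3_of_noPerfectOdd3 (h : NoPerfectOdd3) : QML3 := by
  intro A c
  obtain ⟨n₀, hn₀⟩ := (noPerfectOdd3_iff_cells.1 h) (2 * A + c + 1)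
  refine ⟨2 * (n₀ + 2 ^ (2 ^ (2 * A + c + 6))) + 2 ^ (2 ^ (A + 4)), fun n hn P hP => ?_⟩
  by_contra hlt
  rw [not_le] at hlt
  set L := Nat.log 2 n with hL
  set k := L ^ A with hk
  -- room: `6k + 2 ≤ n`
  have hnA : 2 ^ (2 ^ (A + 4)) ≤ n := le_trans (Nat.le_add_left _ _) hn
  have hn0 : n ≠ 0 := by have := Nat.one_le_two_pow (n := 2 ^ (A + 4)); omega
  have hLA : 2 ^ (A + 4) ≤ L := Nat.le_log_of_pow_le (by norm_num) hnA
  have hL2 : 2 ≤ L := le_trans (by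
    calc 2 = 2 ^ 1 := rfl
      _ ≤ 2 ^ (A + 4) := Nat.pow_le_pow_right (by norm_num) (by omega)) hLA
  have hLn : 2 ^ L ≤ n := Nat.pow_log_le_self 2 hn0
  have hk1 : 1 ≤ k := Nat.one_le_pow _ _ (by omega)
  have hb0 : 1 ≤ 2 ^ (2 ^ (2 * A + c + 6)) := Nat.one_le_two_pow
  have hd0 : 1 ≤ 2 ^ (2 ^ (A + 4)) := Nat.one_le_two_pow
  have hn2 : 2 * (n₀ + 2 ^ (2 ^ (2 * A + c + 6))) + 2 ^ (2 ^ (A + 4)) ≤ n := hn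
  have hroom : 6 * k + 2 ≤ n := by
    have h1 : L ^ (A + 3) < 2 ^ L := pow_lt_two_pow (by simpa [add_assoc] using hLA)
    have h2 : 8 * L ^ A ≤ L ^ (A + 3) := by
      have : 8 ≤ L ^ 3 := by
        calc 8 = 2 ^ 3 := rfl
          _ ≤ L ^ 3 := Nat.pow_le_pow_left hL2 3
      calc 8 * L ^ A ≤ L ^ 3 * L ^ A := Nat.mul_le_mul_right _ this
        _ = L ^ (A + 3) := by ring
    omega
  -- the body: `n = m + 3k + 1`, `m ≥ 2`, `n ≤ 2(m+1)`
  obtain ⟨m, hm, hnm⟩ : ∃ m, 2 ≤ m ∧ n = m + 3 * k + 1 := ⟨n - 3 * k - 1, by omega, by omega⟩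
  have hperf := absorb hnm hm P hP hlt
  have hn2m : n ≤ 2 * (m + 1) := by omega
  have hm1 : n₀ ≤ m + 1 := by omega
  have hmbig : 2 ^ (2 ^ (2 * A + c + 6)) ≤ m + 1 := by omega
  set L' := Nat.log 2 (m + 1) with hL'
  have hL'big : 2 ^ (2 * A + c + 6) ≤ L' := Nat.le_log_of_pow_le (by norm_num) hmbig
  have hLL' : L ≤ L' + 1 := log_le_log_add_one (by omega) hn2m
  -- degree: `(3k+1)²(2 L^c + 1) ≤ 64 L^(2A+c) ≤ 2^6 (L'+1)^(2A+c) ≤ L'^(2A+c+1)`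
  have hdeg : (3 * k + 1) ^ 2 * (2 * L ^ c + 1) ≤ L' ^ (2 * A + c + 1) := by
    have hk1 : 1 ≤ k := Nat.one_le_pow _ _ (by omega)
    have hd1 : 1 ≤ L ^ c := Nat.one_le_pow _ _ (by omega)
    have h1 : (3 * k + 1) ^ 2 * (2 * L ^ c + 1) ≤ 64 * (L ^ A) ^ 2 * L ^ c := by
      have : (3 * k + 1) ^ 2 ≤ 16 * k ^ 2 := by nlinarith
      calc (3 * k + 1) ^ 2 * (2 * L ^ c + 1) ≤ (16 * k ^ 2) * (3 * L ^ c) := Nat.mul_le_mul this (by omega)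
        _ = 48 * (L ^ A) ^ 2 * L ^ c := by rw [hk]; ring
        _ ≤ 64 * (L ^ A) ^ 2 * L ^ c := by nlinarith
    have h2 : 64 * (L ^ A) ^ 2 * L ^ c = 2 ^ 6 * L ^ (2 * A + c) := by ring
    have h3 : 2 ^ 6 * L ^ (2 * A + c) ≤ 2 ^ 6 * (L' + 1) ^ (2 * A + c) :=
      Nat.mul_le_mul_left _ (Nat.pow_le_pow_left hLL' _)
    have h4 : 2 ^ 6 * (L' + 1) ^ (2 * A + c) ≤ L' ^ (2 * A + c + 1) := pow_mul_pow_le hL'big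
    omega
  exact hn₀ (m + 1) hm1 (perfectAt_mono hdeg hperf)

/-- **`NoPerfectOdd3 ⟺ QML3`** — the theorem-pinned FLOOR of the loss ladder: at polylog degree, «some odd loss» and
«at least `2^((log₂ n)^A)` odd losses for every `A`» are the same statement. -/
theorem noPerfectOdd3_iff_qml3 : NoPerfectOdd3 ↔ QML3 := ⟨qml3_of_noPerfectOdd3, noPerfectOdd3_of_qml3⟩

end Absorb

/-! ## The node equation and the deciding theorems -/

section Node

/-- the residual read from exactness IS the residual read from quasi-polynomially many losses (absorption). -/
theorem mesoLift3_iff_exact : MesoLift3 ↔ MesoLiftExact3 := by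
  unfold MesoLift3 MesoLiftExact3
  rw [noPerfectOdd3_iff_qml3]

/-- ★ **THE SCALE SPLIT OF 26533**: `MassStep3u ⟺ MesoLift3 ∧ TopLift3` — the `→`-residual of ExactnessDial cut at
the covariance floor `QFracU3`, with its hypothesis lifted for free to `QML3` by absorption. -/
theorem massStep3u_iff_pieces : MassStep3u ↔ (MesoLift3 ∧ TopLift3) := by
  rw [massStep3u_iff_cut, mesoLift3_iff_exact]

/-- the same with the top piece in its ONE-POLYNOMIAL covariant form. -/
theorem massStep3u_iff_pieces_cov : MassStep3u ↔ (MesoLift3 ∧ CovTopLift3) := by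
  rw [massStep3u_iff_pieces, topLift3_iff_cov]

/-- the junction 26531 three ways: exactness ∧ mesoscopic lift ∧ density upgrade. -/
theorem polyLossOddU3_iff_pieces : PolyLossOddU3 ↔ (NoPerfectOdd3 ∧ MesoLift3 ∧ TopLift3) := by
  constructor
  · intro h
    exact ⟨Summit.QuantumAdvantage.QuantumAdvantage.Theorems.ExactnessDialOddToAll.noPerfectOdd3_of_polyLossOddU3 h,
      (pieces_of_polyLossOddU3 h).1, (pieces_of_polyLossOddU3 h).2.2⟩
  · rintro ⟨hN, hA, hB⟩
    exact hB (hA (qml3_of_noPerfectOdd3 hN))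

/-- **deciding theorem for the target 26533** (both binders consumed). -/
theorem closes_26533 (hA : MesoLift3) (hB : TopLift3) : MassStep3u := massStep3u_iff_pieces.2 ⟨hA, hB⟩

/-- covariant form. -/
theorem closes_26533_cov (hA : MesoLift3) (hB : CovTopLift3) : MassStep3u := massStep3u_iff_pieces_cov.2 ⟨hA, hB⟩

/-- the junction 26531 from 26532 and the two pieces. -/
theorem closes_26531 (hN : NoPerfectOdd3) (hA : MesoLift3) (hB : TopLift3) : PolyLossOddU3 :=
  polyLossOddU3_iff_pieces.2 ⟨hN, hA, hB⟩

/-- **`closes` — the rung leaf BY NAME** through ExactnessDial's own `closes` (`exactnessDial_closes₄`: bridge 26125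
discharged in the tree; 26534 `OddToAll3` is closed in the tree too, `exactnessDial_oddToAll3`, but kept as a binder to
mirror the route's `closes`). -/
theorem closes (hN : NoPerfectOdd3) (hA : MesoLift3) (hB : TopLift3) (hO : OddToAll3) (hD : DPLift3) :
    Summit.QuantumAdvantage.AdviceFreeQNC0.AdviceFreeQNC0Three :=
  Summit.QuantumAdvantage.QuantumAdvantage.Theorems.exactnessDial_closes₄ hN (closes_26533 hA hB) hO hD

/-- `closes` with 26534 discharged by the tree (`exactnessDial_oddToAll3`): four binders. -/
theorem closes₃ (hN : NoPerfectOdd3) (hA : MesoLift3) (hB : TopLift3) (hD : DPLift3) :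
    Summit.QuantumAdvantage.AdviceFreeQNC0.AdviceFreeQNC0Three :=
  closes hN hA hB Summit.QuantumAdvantage.QuantumAdvantage.Theorems.ExactnessDialOddToAll.exactnessDial_oddToAll3 hD

end Node

/-! ## Axiom guards -/

/-- info: 'Summit.QuantumAdvantage.QuantumAdvantage.Theorems.ScaleDial.closes' depends on axioms: [propext, Classical.choice, Quot.sound] -/
#guard_msgs (whitespace := lax) in #print axioms closes

/-- info: 'Summit.QuantumAdvantage.QuantumAdvantage.Theorems.ScaleDial.massStep3u_iff_pieces' depends on axioms: [propext, Classical.choice, Quot.sound] -/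
#guard_msgs (whitespace := lax) in #print axioms massStep3u_iff_pieces

/-- info: 'Summit.QuantumAdvantage.QuantumAdvantage.Theorems.ScaleDial.noPerfectOdd3_iff_qml3' depends on axioms: [propext, Classical.choice, Quot.sound] -/
#guard_msgs (whitespace := lax) in #print axioms noPerfectOdd3_iff_qml3

/-- info: 'Summit.QuantumAdvantage.QuantumAdvantage.Theorems.ScaleDial.absorb' depends on axioms: [propext, Classical.choice, Quot.sound] -/
#guard_msgs (whitespace := lax) in #print axioms absorb

/-- info: 'Summit.QuantumAdvantage.QuantumAdvantage.Theorems.ScaleDial.qFracU3_iff_cov' depends on axioms: [propext, Classical.choice, Quot.sound] -/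
#guard_msgs (whitespace := lax) in #print axioms qFracU3_iff_cov

/-- info: 'Summit.QuantumAdvantage.QuantumAdvantage.Theorems.ScaleDial.polyLossOddU3_iff_pieces' depends on axioms: [propext, Classical.choice, Quot.sound] -/
#guard_msgs (whitespace := lax) in #print axioms polyLossOddU3_iff_pieces

end Summit.QuantumAdvantage.QuantumAdvantage.Theorems.ScaleDial
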